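import Summits.HodgeConjecture.HodgeConjecture.Theorems.F0P3XiLocalLabelsOfMemXiFamily
import Literature.NumberTheory.Rogawski1990.OneDimAutRepHSplitRigidity
import Summits.HodgeConjecture.HodgeConjecture.Theorems.F0P3BetaOppAdmOfClassificationShape
import HarnessLib

/-!
# U♭ OF RECORD: a ξ-local family containing the finite constituents of a discrete `P` with a finite component determines `ξ`
# (`memXiFamily_rigid`; F0P3-plan (g3) rulings (U9)(b)∕(U10)(iii))

Cell `hodgecm-mathlib`, F0∕P3 «U3-mult», crux H413 (`stmt-HodgeConjecture-24833`), rung 4 (family rigidity U♭).  THE FOLD (helper file,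
THEOREMS ONLY: no definition, no named fact, no instance, no notation, no `sorry`) of
* the LOCAL half ★ `F0P3XiLocalLabelsOfMemXiFamily.exists_bc_localComponent_eq_of_memXiFamily` (F0P3-p03 (g6), ED. 2 over the DEFINITE split
  witness of ★ D6 `GlobalAPacketMembership` ED. 2): `MemXiFamily P … ξ` and `MemXiFamily P … ξ′` for ONE discrete `P` with an irreducible
  smooth finite component force `η̃_w = η̃′_w`, `ψ̃_w = ψ̃′_w` at one place `w` above every split `v` (the split member `i_G(ξ_v ⊗ μ_w∘det₀)`
  determines its labels, ★ `Zelevinsky1980.eq_of_areIsomorphicRep_parabolicIndGL_detChar`), and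
* the GLOBAL half ★ `Rogawski1990.OneDimAutRepH.ext_of_exists_bc_localComponent_eq_of_split` (F0P3-p01 (g6): automorphic characters of
  `U(1)_{L/L⁺}` agreeing at the split places are equal — weak approximation for the rational torus, ★ `TorusCharacterSplitRigidity`):
`memXiFamily_rigid : MemXiFamily P … ξ → MemXiFamily P … ξ′ → ξ = ξ′` (guarded by a finite component of `P`), and the letters'-frame form
`memXiFamily_rigid_cm` = token for token the hypothesis `hUσ` of ★ `F0P3BetaOppAdmOfClassificationShape.shape_C3_of_C30_of_rigidFin` ∕
`betaOppAdm_of_C30_of_rigidFin` (F0P3-p04 (g6)); §2 then DISCHARGES that hypothesis: `shape_C3_of_C30_of_finComponents` ((C3) ⇐ (C3₀) + finite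
components) and `betaOppAdm_of_C30` (the line's `StubBetaOppAdm` body ⇐ (C3₀)), so that (C3), hence R♭ and β_opp, follow from the ONE engine
letter (C3₀).  0 letters.
HC_CM is proved only modulo the printed citations until rung 0 closes.

References: [Rogawski1990] §13.1 p. 199 (`Π(ξ)` is indexed by `ξ`), §12.2 pp. 173–174, §4.13 Lemma 4.13.1 (b); [Zelevinsky1980] Thm. 4.2;
[CasselsFrohlichANT1967] Ch. VII §4 Prop. 4.1; [PlatonovRapinchuk1994] §7.3 Prop. 7.8.
-/

-- Mathlib idiom (as in ★ `GlobalAPacketLetters`, ★ `F0P3BetaOppAdmOfClassificationShape`): the commutator bracket on `Module.End ℂ M`,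
-- needed to MENTION `(uFormGroup (Fin 2) (Fin 1)).lie →ₗ⁅ℝ⁆ Module.End ℂ M` in the §2 statements.
attribute [local instance 100] LieRing.ofAssociativeRing

set_option autoImplicit false
set_option linter.dupNamespace false

noncomputable section

open NumberField IsDedekindDomain MeasureTheory
open scoped Matrix ComplexOrder

namespace Summit.HodgeConjecture.HodgeConjecture.Cruxes.H413.F0P3XiRigid

open Literature.NumberTheory.Automorphic Literature.NumberTheory.Automorphic.UnitaryGroup
open Literature.NumberTheory.Automorphic.UnitaryGroup.CotangentForms
open Literature.NumberTheory.GaloisRepresentations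
open Literature.NumberTheory.Rogawski1990
open Literature.RepresentationTheory.BorelWallach2000
open Literature.RepresentationTheory.KonnoKonno2007 Literature.RepresentationTheory.KonnoKonno2007.RealDualPair
open Literature.RepresentationTheory.KonnoKonno2007.RealDualPair.UForm
open Summit.HodgeConjecture.HodgeConjecture.Cruxes.H413.F0P3XiLocalLabelsOfMemXiFamily

variable {L : Type} [Field L] [NumberField L] [IsCMField L] {H : Matrix (Fin 3) (Fin 3) L}
  (hH : (H.map (cmConjRingHom L))ᵀ = H) (hHd : IsUnit H.det)
  {μ : Measure (adelicGroupData (↥(maximalRealSubfield L)) L (IsCMField.complexConj L) 3 H).automorphicQuotient}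
  [(adelicGroupData (↥(maximalRealSubfield L)) L (IsCMField.complexConj L) 3 H).IsAutomorphicMeasure μ]

/-- **U♭ — FAMILY RIGIDITY.**  For a hermitian `H ∈ M₃(L)` with unit determinant, an automorphic measure, Rogawski's auxiliary
unitary Hecke character `μω`, and a discrete automorphic `P` of `U(H)` with an irreducible smooth finite component `σ`: if `P` lies in
the ξ-local family AND in the ξ′-local family (★ `MemXiFamily`, ED. 2), then `ξ = ξ′`.  LOCAL half ★
`exists_bc_localComponent_eq_of_memXiFamily` (one place above every split `v`), GLOBAL half ★
`OneDimAutRepH.ext_of_exists_bc_localComponent_eq_of_split`. [cite: Rogawski1990, §13.1 p. 199; §12.2 pp. 173–174]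
[cite: Zelevinsky1980, Thm. 4.2] [cite: CasselsFrohlichANT1967, Ch. VII §4 Prop. 4.1] [cite: PlatonovRapinchuk1994, §7.3 Prop. 7.8] -/
theorem memXiFamily_rigid
    (P : DiscreteAutomorphicRep (adelicGroupData (↥(maximalRealSubfield L)) L (IsCMField.complexConj L) 3 H) μ)
    {W : Type} [AddCommGroup W] [Module ℂ W]
    {σ : Representation ℂ (finAdelic (↥(maximalRealSubfield L)) L (IsCMField.complexConj L) 3 H) W}
    (hirr : σ.IsIrreducible) (hsm : σ.IsSmooth) (hP : P.HasFinComponent σ)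
    (μω : HeckeCharacter L) (hμu : μω.IsUnitary) (ξ ξ' : OneDimAutRepH L)
    (h : MemXiFamily P hH hHd μω hμu ξ) (h' : MemXiFamily P hH hHd μω hμu ξ') : ξ = ξ' :=
  OneDimAutRepH.ext_of_exists_bc_localComponent_eq_of_split fun v hs => by
    obtain ⟨w, -, hη, hψ⟩ :=
      F0P3XiLocalLabelsOfMemXiFamily.exists_bc_localComponent_eq_of_memXiFamily hH hHd P hirr hsm hP ξ ξ' μω hμu h h' v hs
    exact ⟨w, hη, hψ⟩

omit hH hHd μ in
/-- **U♭ AT THE LETTERS' FRAME** (token for token the hypothesis `hUσ` of ★ `F0P3BetaOppAdmOfClassificationShape.shape_C3_of_C30_of_rigidFin`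
∕ `betaOppAdm_of_C30_of_rigidFin`): frame `(L ι H T hT) hdef h2 (μ) (μω hμu) hμω`, then for every discrete `P` with an irreducible
smooth finite component, `MemXiFamily P … ξ → MemXiFamily P … ξ′ → ξ = ξ′`. [cite: Rogawski1990, §13.1 p. 199]
[cite: Zelevinsky1980, Thm. 4.2] [cite: CasselsFrohlichANT1967, Ch. VII §4 Prop. 4.1] [cite: PlatonovRapinchuk1994, §7.3 Prop. 7.8] -/
theorem memXiFamily_rigid_cm :
    ∀ (L : Type) [Field L] [NumberField L] [IsCMField L] (ι : L →+* ℂ) (H : Matrix (Fin 3) (Fin 3) L) (T : GL (Fin 3) ℂ)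
      (hT : (T : Matrix (Fin 3) (Fin 3) ℂ)ᴴ * H.map ι * (T : Matrix (Fin 3) (Fin 3) ℂ) = Literature.Geometry.ComplexHyperbolic.BallModel.J),
      (∀ τ' : L →+* ℂ, InfinitePlace.mk τ' ≠ InfinitePlace.mk ι → (H.map τ').PosDef) →
      2 ≤ Module.finrank ℚ ↥(maximalRealSubfield L) →
      ∀ (μ : Measure (adelicGroupData (↥(maximalRealSubfield L)) L (IsCMField.complexConj L) 3 H).automorphicQuotient)
        [(adelicGroupData (↥(maximalRealSubfield L)) L (IsCMField.complexConj L) 3 H).IsAutomorphicMeasure μ]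
        (μω : HeckeCharacter L) (hμu : μω.IsUnitary),
        (∀ x : Literature.NumberTheory.GaloisRepresentations.ideleGroup ↥(maximalRealSubfield L),
          μω (AdeleRing.ideleBaseChange (↥(maximalRealSubfield L)) L x) = quadraticHeckeCharCM L x) →
      ∀ (P : DiscreteAutomorphicRep (adelicGroupData (↥(maximalRealSubfield L)) L (IsCMField.complexConj L) 3 H) μ)
        (W : Type) [AddCommGroup W] [Module ℂ W]
        (σ : Representation ℂ (finAdelic (↥(maximalRealSubfield L)) L (IsCMField.complexConj L) 3 H) W),
        σ.IsIrreducible → σ.IsSmooth → P.HasFinComponent σ →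
        ∀ (ξ ξ' : OneDimAutRepH L), MemXiFamily P (transpose_map_cmConjRingHom_eq_of_frame L ι H T hT) (isUnit_det_of_frame L ι H T hT) μω hμu ξ →
          MemXiFamily P (transpose_map_cmConjRingHom_eq_of_frame L ι H T hT) (isUnit_det_of_frame L ι H T hT) μω hμu ξ' → ξ = ξ' :=
  fun L _ _ _ ι H T hT _ _ _ _ μω hμu _ P _ _ _ _ hirr hsm hP ξ ξ' h h' =>
    memXiFamily_rigid (transpose_map_cmConjRingHom_eq_of_frame L ι H T hT) (isUnit_det_of_frame L ι H T hT) P hirr hsm hP μω hμu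
      ξ ξ' h h'

/-! ## §2 Discharging U♭ in the (C3₀)-folds of ★ `F0P3BetaOppAdmOfClassificationShape` (F0P3-p04 (g6)) -/

/-- **(C3) FROM (C3₀) ALONE, given finite components for token-carrying `P`** (★ `shape_C3_of_C30_of_rigidFin` with its `hUσ` := ★
`memXiFamily_rigid_cm`): the engine owes (C3₀) (and E1); U♭ is in-house.
[cite: Rogawski1990, §13.1 p. 199; §12.3 p. 178; Thm. 13.3.6 (c); §14.6 Thm. 14.6.4] [cite: Zelevinsky1980, Thm. 4.2] [cite: PlatonovRapinchuk1994, §7.3 Prop. 7.8] -/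
theorem shape_C3_of_C30_of_finComponents
    (hC30 : ∀ (L : Type) [Field L] [NumberField L] [IsCMField L] (ι : L →+* ℂ) (H : Matrix (Fin 3) (Fin 3) L) (T : GL (Fin 3) ℂ)
      (hT : (T : Matrix (Fin 3) (Fin 3) ℂ)ᴴ * H.map ι * (T : Matrix (Fin 3) (Fin 3) ℂ) = Literature.Geometry.ComplexHyperbolic.BallModel.J),
      (∀ τ' : L →+* ℂ, InfinitePlace.mk τ' ≠ InfinitePlace.mk ι → (H.map τ').PosDef) →
      2 ≤ Module.finrank ℚ ↥(maximalRealSubfield L) →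
      ∀ (μ : Measure (adelicGroupData (↥(maximalRealSubfield L)) L (IsCMField.complexConj L) 3 H).automorphicQuotient)
        [(adelicGroupData (↥(maximalRealSubfield L)) L (IsCMField.complexConj L) 3 H).IsAutomorphicMeasure μ]
        (μω : HeckeCharacter L) (hμu : μω.IsUnitary),
        (∀ x : Literature.NumberTheory.GaloisRepresentations.ideleGroup ↥(maximalRealSubfield L),
          μω (AdeleRing.ideleBaseChange (↥(maximalRealSubfield L)) L x) = quadraticHeckeCharCM L x) →
      ∃ sgn : OneDimAutRepH L → ℤ,
        ∀ (P : DiscreteAutomorphicRep (adelicGroupData (↥(maximalRealSubfield L)) L (IsCMField.complexConj L) 3 H) μ),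
          ∀ (M : Type) [AddCommGroup M] [Module ℂ M] (σK : Representation ℂ (uFormGroup (Fin 2) (Fin 1)).maximalCompact M)
            (σ𝔤 : (uFormGroup (Fin 2) (Fin 1)).lie →ₗ⁅ℝ⁆ Module.End ℂ M) (hM : IsGKModule (uFormGroup (Fin 2) (Fin 1)) σK σ𝔤),
            IsIrreducibleGK σK σ𝔤 →
            (∃ T₁ : P.archModuleCM ι T hT →ₗ[ℂ] M,
              (∀ (k : (uFormGroup (Fin 2) (Fin 1)).maximalCompact) (w : P.archModuleCM ι T hT),
                  T₁ (P.archRepKCM ι T hT k w) = σK k (T₁ w)) ∧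
                (∀ (X : (uFormGroup (Fin 2) (Fin 1)).lie) (w : P.archModuleCM ι T hT),
                  T₁ (P.archRepLieCM ι T hT X w) = σ𝔤 X (T₁ w)) ∧ T₁ ≠ 0) →
            ∀ δ : ℤ, (δ = 1 ∨ δ = -1) → upqTypeClasses σK σ𝔤 hM.ad_compat 1 δ ≠ ⊥ →
            ∃ ξ : OneDimAutRepH L, MemXiFamily P (transpose_map_cmConjRingHom_eq_of_frame L ι H T hT) (isUnit_det_of_frame L ι H T hT) μω hμu ξ ∧ δ = sgn ξ)
    (hF : ∀ (L : Type) [Field L] [NumberField L] [IsCMField L] (ι : L →+* ℂ) (H : Matrix (Fin 3) (Fin 3) L) (T : GL (Fin 3) ℂ)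
      (hT : (T : Matrix (Fin 3) (Fin 3) ℂ)ᴴ * H.map ι * (T : Matrix (Fin 3) (Fin 3) ℂ) = Literature.Geometry.ComplexHyperbolic.BallModel.J),
      (∀ τ' : L →+* ℂ, InfinitePlace.mk τ' ≠ InfinitePlace.mk ι → (H.map τ').PosDef) →
      2 ≤ Module.finrank ℚ ↥(maximalRealSubfield L) →
      ∀ (μ : Measure (adelicGroupData (↥(maximalRealSubfield L)) L (IsCMField.complexConj L) 3 H).automorphicQuotient)
        [(adelicGroupData (↥(maximalRealSubfield L)) L (IsCMField.complexConj L) 3 H).IsAutomorphicMeasure μ]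
        (μω : HeckeCharacter L) (hμu : μω.IsUnitary),
        (∀ x : Literature.NumberTheory.GaloisRepresentations.ideleGroup ↥(maximalRealSubfield L),
          μω (AdeleRing.ideleBaseChange (↥(maximalRealSubfield L)) L x) = quadraticHeckeCharCM L x) →
      ∀ (P : DiscreteAutomorphicRep (adelicGroupData (↥(maximalRealSubfield L)) L (IsCMField.complexConj L) 3 H) μ),
          ∀ (M : Type) [AddCommGroup M] [Module ℂ M] (σK : Representation ℂ (uFormGroup (Fin 2) (Fin 1)).maximalCompact M)
            (σ𝔤 : (uFormGroup (Fin 2) (Fin 1)).lie →ₗ⁅ℝ⁆ Module.End ℂ M) (hM : IsGKModule (uFormGroup (Fin 2) (Fin 1)) σK σ𝔤),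
            IsIrreducibleGK σK σ𝔤 →
            (∃ T₁ : P.archModuleCM ι T hT →ₗ[ℂ] M,
              (∀ (k : (uFormGroup (Fin 2) (Fin 1)).maximalCompact) (w : P.archModuleCM ι T hT),
                  T₁ (P.archRepKCM ι T hT k w) = σK k (T₁ w)) ∧
                (∀ (X : (uFormGroup (Fin 2) (Fin 1)).lie) (w : P.archModuleCM ι T hT),
                  T₁ (P.archRepLieCM ι T hT X w) = σ𝔤 X (T₁ w)) ∧ T₁ ≠ 0) →
            ∀ δ : ℤ, (δ = 1 ∨ δ = -1) → upqTypeClasses σK σ𝔤 hM.ad_compat 1 δ ≠ ⊥ →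
            ∃ (W : Type) (_ : AddCommGroup W) (_ : Module ℂ W)
              (σ : Representation ℂ (finAdelic (↥(maximalRealSubfield L)) L (IsCMField.complexConj L) 3 H) W),
              σ.IsIrreducible ∧ σ.IsSmooth ∧ P.HasFinComponent σ) :
    ∀ (L : Type) [Field L] [NumberField L] [IsCMField L] (ι : L →+* ℂ) (H : Matrix (Fin 3) (Fin 3) L) (T : GL (Fin 3) ℂ)
      (hT : (T : Matrix (Fin 3) (Fin 3) ℂ)ᴴ * H.map ι * (T : Matrix (Fin 3) (Fin 3) ℂ) = Literature.Geometry.ComplexHyperbolic.BallModel.J),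
      (∀ τ' : L →+* ℂ, InfinitePlace.mk τ' ≠ InfinitePlace.mk ι → (H.map τ').PosDef) →
      2 ≤ Module.finrank ℚ ↥(maximalRealSubfield L) →
      ∀ (μ : Measure (adelicGroupData (↥(maximalRealSubfield L)) L (IsCMField.complexConj L) 3 H).automorphicQuotient)
        [(adelicGroupData (↥(maximalRealSubfield L)) L (IsCMField.complexConj L) 3 H).IsAutomorphicMeasure μ]
        (μω : HeckeCharacter L) (hμu : μω.IsUnitary),
        (∀ x : Literature.NumberTheory.GaloisRepresentations.ideleGroup ↥(maximalRealSubfield L),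
          μω (AdeleRing.ideleBaseChange (↥(maximalRealSubfield L)) L x) = quadraticHeckeCharCM L x) →
      ∃ sgn : OneDimAutRepH L → ℤ,
        ∀ (P : DiscreteAutomorphicRep (adelicGroupData (↥(maximalRealSubfield L)) L (IsCMField.complexConj L) 3 H) μ)
          (ξ : OneDimAutRepH L),
          MemXiFamily P (transpose_map_cmConjRingHom_eq_of_frame L ι H T hT) (isUnit_det_of_frame L ι H T hT) μω hμu ξ →
          ∀ (M : Type) [AddCommGroup M] [Module ℂ M] (σK : Representation ℂ (uFormGroup (Fin 2) (Fin 1)).maximalCompact M)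
            (σ𝔤 : (uFormGroup (Fin 2) (Fin 1)).lie →ₗ⁅ℝ⁆ Module.End ℂ M) (hM : IsGKModule (uFormGroup (Fin 2) (Fin 1)) σK σ𝔤),
            IsIrreducibleGK σK σ𝔤 →
            (∃ T₁ : P.archModuleCM ι T hT →ₗ[ℂ] M,
              (∀ (k : (uFormGroup (Fin 2) (Fin 1)).maximalCompact) (w : P.archModuleCM ι T hT),
                  T₁ (P.archRepKCM ι T hT k w) = σK k (T₁ w)) ∧
                (∀ (X : (uFormGroup (Fin 2) (Fin 1)).lie) (w : P.archModuleCM ι T hT),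
                  T₁ (P.archRepLieCM ι T hT X w) = σ𝔤 X (T₁ w)) ∧ T₁ ≠ 0) →
            ∀ δ : ℤ, (δ = 1 ∨ δ = -1) → upqTypeClasses σK σ𝔤 hM.ad_compat 1 δ ≠ ⊥ → δ = sgn ξ :=
  F0P3BetaOppAdmOfClassificationShape.shape_C3_of_C30_of_rigidFin hC30 memXiFamily_rigid_cm hF

/-- **β_opp-adm FROM (C3₀) ALONE** (★ `betaOppAdm_of_C30_of_rigidFin` with its `hUσ` := ★ `memXiFamily_rigid_cm`): the `StubBetaOppAdm`
body of the line `Cruxes/H413/Lines/F0_U3LettersRung1.lean` follows from the engine letter (C3₀) and tree theorems only (T♭, U♭).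
[cite: Rogawski1990, Thm. 13.3.6 (c); §14.6 Thm. 14.6.4; §12.3 p. 178; Prop. 15.2.1 (b)] [cite: Zelevinsky1980, Thm. 4.2] [cite: PlatonovRapinchuk1994, §7.3 Prop. 7.8] -/
theorem betaOppAdm_of_C30
    (hC30 : ∀ (L : Type) [Field L] [NumberField L] [IsCMField L] (ι : L →+* ℂ) (H : Matrix (Fin 3) (Fin 3) L) (T : GL (Fin 3) ℂ)
      (hT : (T : Matrix (Fin 3) (Fin 3) ℂ)ᴴ * H.map ι * (T : Matrix (Fin 3) (Fin 3) ℂ) = Literature.Geometry.ComplexHyperbolic.BallModel.J),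
      (∀ τ' : L →+* ℂ, InfinitePlace.mk τ' ≠ InfinitePlace.mk ι → (H.map τ').PosDef) →
      2 ≤ Module.finrank ℚ ↥(maximalRealSubfield L) →
      ∀ (μ : Measure (adelicGroupData (↥(maximalRealSubfield L)) L (IsCMField.complexConj L) 3 H).automorphicQuotient)
        [(adelicGroupData (↥(maximalRealSubfield L)) L (IsCMField.complexConj L) 3 H).IsAutomorphicMeasure μ]
        (μω : HeckeCharacter L) (hμu : μω.IsUnitary),
        (∀ x : Literature.NumberTheory.GaloisRepresentations.ideleGroup ↥(maximalRealSubfield L),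
          μω (AdeleRing.ideleBaseChange (↥(maximalRealSubfield L)) L x) = quadraticHeckeCharCM L x) →
      ∃ sgn : OneDimAutRepH L → ℤ,
        ∀ (P : DiscreteAutomorphicRep (adelicGroupData (↥(maximalRealSubfield L)) L (IsCMField.complexConj L) 3 H) μ),
          ∀ (M : Type) [AddCommGroup M] [Module ℂ M] (σK : Representation ℂ (uFormGroup (Fin 2) (Fin 1)).maximalCompact M)
            (σ𝔤 : (uFormGroup (Fin 2) (Fin 1)).lie →ₗ⁅ℝ⁆ Module.End ℂ M) (hM : IsGKModule (uFormGroup (Fin 2) (Fin 1)) σK σ𝔤),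
            IsIrreducibleGK σK σ𝔤 →
            (∃ T₁ : P.archModuleCM ι T hT →ₗ[ℂ] M,
              (∀ (k : (uFormGroup (Fin 2) (Fin 1)).maximalCompact) (w : P.archModuleCM ι T hT),
                  T₁ (P.archRepKCM ι T hT k w) = σK k (T₁ w)) ∧
                (∀ (X : (uFormGroup (Fin 2) (Fin 1)).lie) (w : P.archModuleCM ι T hT),
                  T₁ (P.archRepLieCM ι T hT X w) = σ𝔤 X (T₁ w)) ∧ T₁ ≠ 0) →
            ∀ δ : ℤ, (δ = 1 ∨ δ = -1) → upqTypeClasses σK σ𝔤 hM.ad_compat 1 δ ≠ ⊥ →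
            ∃ ξ : OneDimAutRepH L, MemXiFamily P (transpose_map_cmConjRingHom_eq_of_frame L ι H T hT) (isUnit_det_of_frame L ι H T hT) μω hμu ξ ∧ δ = sgn ξ) :
    ∀ (L : Type) [Field L] [NumberField L] [IsCMField L] (ι : L →+* ℂ) (H : Matrix (Fin 3) (Fin 3) L) (T : GL (Fin 3) ℂ)
      (hT : (T : Matrix (Fin 3) (Fin 3) ℂ)ᴴ * H.map ι * (T : Matrix (Fin 3) (Fin 3) ℂ) = Literature.Geometry.ComplexHyperbolic.BallModel.J),
      (∀ τ' : L →+* ℂ, InfinitePlace.mk τ' ≠ InfinitePlace.mk ι → (H.map τ').PosDef) →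
      2 ≤ Module.finrank ℚ ↥(maximalRealSubfield L) →
      ∀ (μ : Measure (adelicGroupData (↥(maximalRealSubfield L)) L (IsCMField.complexConj L) 3 H).automorphicQuotient)
        [(adelicGroupData (↥(maximalRealSubfield L)) L (IsCMField.complexConj L) 3 H).IsAutomorphicMeasure μ]
        (W : Type) [AddCommGroup W] [Module ℂ W]
        (σ : Representation ℂ (finAdelic (↥(maximalRealSubfield L)) L (IsCMField.complexConj L) 3 H) W),
        σ.IsIrreducible → σ.IsSmooth → σ.IsAdmissible →
      ∀ (P P' : DiscreteAutomorphicRep (adelicGroupData (↥(maximalRealSubfield L)) L (IsCMField.complexConj L) 3 H) μ),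
        P.HasFinComponent σ → P'.HasFinComponent σ →
      ∀ (M : Type) [AddCommGroup M] [Module ℂ M] (σK : Representation ℂ (uFormGroup (Fin 2) (Fin 1)).maximalCompact M)
        (σ𝔤 : (uFormGroup (Fin 2) (Fin 1)).lie →ₗ⁅ℝ⁆ Module.End ℂ M) (hM : IsGKModule (uFormGroup (Fin 2) (Fin 1)) σK σ𝔤),
        IsIrreducibleGK σK σ𝔤 →
        (∃ T₁ : P.archModuleCM ι T hT →ₗ[ℂ] M,
          (∀ (k : (uFormGroup (Fin 2) (Fin 1)).maximalCompact) (w : P.archModuleCM ι T hT),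
              T₁ (P.archRepKCM ι T hT k w) = σK k (T₁ w)) ∧
            (∀ (X : (uFormGroup (Fin 2) (Fin 1)).lie) (w : P.archModuleCM ι T hT),
              T₁ (P.archRepLieCM ι T hT X w) = σ𝔤 X (T₁ w)) ∧ T₁ ≠ 0) →
      ∀ (M' : Type) [AddCommGroup M'] [Module ℂ M'] (σK' : Representation ℂ (uFormGroup (Fin 2) (Fin 1)).maximalCompact M')
        (σ𝔤' : (uFormGroup (Fin 2) (Fin 1)).lie →ₗ⁅ℝ⁆ Module.End ℂ M') (hM' : IsGKModule (uFormGroup (Fin 2) (Fin 1)) σK' σ𝔤'),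
        IsIrreducibleGK σK' σ𝔤' →
        (∃ T₂ : P'.archModuleCM ι T hT →ₗ[ℂ] M',
          (∀ (k : (uFormGroup (Fin 2) (Fin 1)).maximalCompact) (w : P'.archModuleCM ι T hT),
              T₂ (P'.archRepKCM ι T hT k w) = σK' k (T₂ w)) ∧
            (∀ (X : (uFormGroup (Fin 2) (Fin 1)).lie) (w : P'.archModuleCM ι T hT),
              T₂ (P'.archRepLieCM ι T hT X w) = σ𝔤' X (T₂ w)) ∧ T₂ ≠ 0) →
        upqTypeClasses σK σ𝔤 hM.ad_compat 1 1 ≠ ⊥ → upqTypeClasses σK' σ𝔤' hM'.ad_compat 1 (-1) ≠ ⊥ → False :=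
  F0P3BetaOppAdmOfClassificationShape.betaOppAdm_of_C30_of_rigidFin hC30 memXiFamily_rigid_cm

end Summit.HodgeConjecture.HodgeConjecture.Cruxes.H413.F0P3XiRigid

end
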